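/-
Copyright (c) 2026. All rights reserved.
Released under Apache 2.0 license as described in the file LICENSE.
-/
import Literature.AlgebraicGeometry.ComplexMultiplication.CyclotomicFermatCMTypesPrimeLevelDegenerate
import Literature.AlgebraicGeometry.ComplexMultiplication.CyclotomicFermatCMTypesPrimeLevelSimple
import Literature.AlgebraicGeometry.ComplexMultiplication.CyclotomicFermatCMTypesPrimeLevelThreshold
import Mathlib.LinearAlgebra.Matrix.Rank
import Mathlib.LinearAlgebra.Matrix.NonsingularInverse
import Mathlib.GroupTheory.QuotientGroup.Basic
import Mathlib.GroupTheory.Coset.Card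
import Mathlib.Algebra.Pointwise.Stabilizer
import HarnessLib

/-!
# The Demjanenko matrix of a CM type: Kubota's Lemma 1 / Fité–González–Lario's Lemma 3.3
# `rank(M) = rk(D) + 1`, and Fité–Shparlinski's `K_ℓ = {k : D_{k,ℓ} singular}` (Lemma 6) as a theorem

Layer `Literature/AlgebraicGeometry/ComplexMultiplication` (next to `CyclotomicFermatCMTypesPrimeLevel*`).  ONE
definition with a body — the (generalized) Demjanenko matrix `demjanenkoMatrix ρ M = (E(ρc⁻¹a) − 1/2)_{c,a ∈ M}` of a
subset `M` of a group `G` — and THEOREMS; no named fact, no `sorry`.  The CM-type notions are the tree's: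
`IsCMTypeWith ρ Φ`, `translateInd`, `antiVec`, `antiSpan`, `typeRank` (`NumberTheory/ComplexMultiplication/CMTypeRank`:
Kubota–Dodson rank = dimension of the span of the indicators of the translates `g⁻¹Φ`), `cmTypeRank`,
`IsNondegenerate` (`Pohlmann1968`), `cmTypeOfResidues` (the CM type `Φ_S` of `ℚ(ζ_N)` cut out by a residue set),
`fermatCMType p 1 k (−1−k)` (`= S_k = M_k`, the type of the Fermat quotient `C_k`).

## The print

* F. Fité, J. González, J.-C. Lario, *Frobenius distribution for quotients of Fermat curves of prime exponent*,
  Canad. J. Math. 68 (2016) [FiteGonzalezLario2016] (held `paper:arxiv-1403.0807`, p0008): **Definition 3.1**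
  "For `k ∈ {1, …, ℓ−2}` and for `a ∈ G`, define `E_k(a) := 0` if `a ∈ M_k`, `1` if `a ∉ M_k`.  The generalized
  `k`-Demjanenko matrix is defined as `D_k := (E_k(−c⁻¹a) − 1/2)_{c,a ∈ M_k/W_k}`.  We will denote the size of `D_k`
  by `r_k := (ℓ−1)/(2n_k)` (recall that `n_k = |W_k|`).  The notion of rank of `M_k/W_k` was first introduced by
  Kubota [Kub65].  It is by definition the rank of `Φ*_k(ℤ[G/W_k])`, where
  `Φ*_k([a]) = Σ_{b ∈ M_k/W_k} [b⁻¹][a] = Σ_{c ∈ G/W_k} E_k(−c⁻¹a)[c]`."  **Lemma 3.3** "(see Lemma 1 of [Kub65]).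
  The rank of `M_k/W_k` is equal to `rk(D_k) + 1`."  (Proof: the matrix `A = (E_k(−c⁻¹a))_{c,a ∈ G/W_k}` of `Φ*_k`
  in the basis `M_k/W_k ∪ M_{−k}/W_k` is `[[D_k + ½U, ½U − D_k], [½U − D_k, D_k + ½U]] ∼ [[D_k, U], [0, 2U]]`.)
  "We say that `M_k/W_k` is non-degenerate if its rank is `r_k + 1`, equivalently, if `rk(D_k)` is maximal, that
  is, if `D_k` has determinant distinct from zero".  **Theorem 1.2 = 4.10**: "In this case
  `dim(Hg(Jac(C_k))) = rk(D_k) = (ℓ−1)/2 · (1 − 2/N_k)`".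
* F. Fité, I. E. Shparlinski, *On the singularity of the Demjanenko matrix of quotients of Fermat curves*, PAMS
  144 (2016) [FiteShparlinski2016] (held `paper:arxiv-1404.5178`), §1 p. 55: "`M_{k,ℓ} := {j ∈ (ℤ/ℓℤ)^* |
  ⟨kj⟩_ℓ + ⟨j⟩_ℓ < ℓ}` … a set of cardinality `(ℓ−1)/2`.  Koblitz and Rohrlich [KR78] show that the subgroup
  `W_{k,ℓ} := {w ∈ (ℤ/ℓℤ)^* | wM_{k,ℓ} = M_{k,ℓ}}` … has cardinality `3` or `1` depending on whether the parameter
  `k` is a primitive cubic root of unity modulo `ℓ` or not.  The Demjanenko matrix is then defined as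
  `D_{k,ℓ} := (E_{k,ℓ}(−c⁻¹a) − 1/2)_{c,a ∈ M_{k,ℓ}/W_{k,ℓ}}` … Let `K_ℓ` denote the set of positive integers
  `k ≤ ℓ−2` for which `D_{k,ℓ}` is singular."  **Lemma 6**: "`k ∈ K_ℓ` if and only if (i) `ord_ℓ k ≠ 3`;
  (ii) `ν₂(ord_ℓ k) = ν₂(ord_ℓ(−k²−k)) = 0`; (iii) `ν₃(ord_ℓ k) > ν₃(ord_ℓ(k²+k))`."  **Theorem 1**, **Corollary 2**.
* T. Kubota, *On the field extension by complex multiplication*, Trans. AMS 118 (1965) [Kubota1965] (held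
  `paper:doi-10-1090-s0002-9947-1965-0190144-8`, p0003–p0005 = pp. 115–117), §2: "`γᵢⱼ = 1` if `φᵢψⱼ ∈ S`, `−1`
  otherwise.  Then `C = (γᵢⱼ)` is an `m × m*` matrix … we define the rank of the CM-type `(F; {φᵢ})` by
  `rank(F; {φᵢ}) = rank C + 1` … We say that `(F; {φᵢ})` … is nondegenerate if `rank(F; {φᵢ}) = m + 1`."
  **Lemma 1.** "Let `P(G)` be the group ring of `G` over a principal ideal domain `R`.  Let `Φ` be the operator
  which maps `x ∈ P(G)` to `x^Φ = Σ_{σ∈S} xσ`.  Then the dimension of `P(G)^Φ` over `R` is equal to the rank of the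
  CM-type" (proof pp. 116–117: `rank [[M, J−M], [J−M, M]] = rank M + 1 = rank(2M − J) + 1`).

For an abelian CM field which is its own reflex setting (`G` acting on itself, `S = M`), Kubota's `C` is `2Dᵀ`
(`demjanenkoMatrix_apply_eq`), and the tree's `typeRank` is Dodson's/Kubota's "dimension of `P(G)^Φ`"; so
Lemma 3.3 = Lemma 1 reads `typeRank G M = rk(D) + 1`, which is what is proved here — by Shimura's route already in
the tree (`IsCMTypeWith.typeRank_eq_finrank_antiSpan_add_one`: `rank = dim U + 1`, `U = span{u_g = 2·𝟙_{g⁻¹M} − 1}`):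
the rows of `D` are the halves of the `u_{c⁻¹}` (`c ∈ M`) restricted to `M`, the `u_{c⁻¹}` span `U`
(`u_{gρ} = −u_g`), and restriction to `M` is injective on `U` (its elements are `ρ`-odd, `G = M ⊔ ρM`).

## What is proved

* §0 `apply_rho_mul_of_mem_antiSpan` (elements of `U` are `ρ`-odd), `rho_mul_rho`.
* §1 **`demjanenkoMatrix`** (Definition 3.1 / [FS] §1, for any `M ⊆ G` and `ρ`), `demjanenkoMatrix_apply`,
  **`demjanenkoMatrix_apply_eq`** (`D_{c,a} = ½u_{c⁻¹}(a) = ±½`), `two_mul_demjanenkoMatrix_apply_mem`.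
* §2 **`rank_demjanenkoMatrix_add_one`** — KUBOTA'S LEMMA 1 / FGL LEMMA 3.3: `rk(D) + 1 = typeRank G M` for every
  CM type `M` of a finite group `G` (central involution `ρ`); `two_mul_card_eq_card` (`2|M| = |G|`),
  `rank_demjanenkoMatrix_le`, **`rank_demjanenkoMatrix_eq_card_iff`** / **`det_demjanenkoMatrix_ne_zero_iff`** /
  `det_demjanenkoMatrix_eq_zero_iff` (nondegenerate `⟺ rk D = |M| ⟺ det D ≠ 0`).
* §3 (the printed indexing `M/W`) `mem_image_mk_iff`, **`isCMTypeWith_image_mk`** (`M/W` is a CM type of `G/W` for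
  `W` normal with `WM = M`), **`typeRank_image_mk_eq`** (`rank_{G/W}(M/W) = rank_G(M)`),
  **`rank_demjanenkoMatrix_image_mk_add_one`** (Lemma 3.3 verbatim on `M/W`), `det_demjanenkoMatrix_image_mk_ne_zero_iff`,
  `two_mul_card_image_mk_eq` (`2r = |G/W|`).
* §4 (`ℚ(ζ_N)`, any `N`) **`rank_demjanenkoMatrix_unitsFilter_add_one`** (`rk(D_S) + 1 = cmTypeRank Φ_S`),
  **`isNondegenerate_cmTypeOfResidues_iff_det_ne_zero`**, `not_isNondegenerate_cmTypeOfResidues_iff_det_eq_zero`.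
* §5 (prime level, the Fermat sets `M_k = S_k`) `mem_unitsFilter_fermat_iff` (`M_{k,ℓ}` as printed),
  **`rank_demjanenkoMatrix_fermat_eq_ite`** (FGL Thm. 1.2: `rk(D_k) = (ℓ−1)/2 − (ℓ−1)/N_k` under (b), (c), else
  `(ℓ−1)/2`), **`det_demjanenkoMatrix_fermat_eq_zero_iff`** (`det D_k = 0 ⟺` (b) ∧ (c), `D_k` on `M_k`),
  `rank_demjanenkoMatrix_fermat_add_one`; the stabiliser **`mem_stabilizer_fermat_iff`** (K–R: `W_{k,ℓ} = 1` or
  `{1, k, k²}`), `stabilizer_fermat_eq_bot_iff` (`W = 1 ⟺ ord k ≠ 3`), `stabilizer_fermat_eq_zpowers`,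
  `card_stabilizer_fermat_of_pow_three` (`|W| = 3`), **`det_demjanenkoMatrix_quotient_fermat_ne_zero_of_pow_three`**
  (`ord k = 3`: `D_{k,ℓ}` on `M/W`, size `(ℓ−1)/6`, is NON-singular), and **[FS] LEMMA 6 VERBATIM**
  **`det_demjanenkoMatrix_quotient_fermat_eq_zero_iff`**: `det D_{k,ℓ} = 0 ⟺ ord k ≠ 3 ∧ (ii) ∧ (iii)`.
* §6 `filter_det_demjanenkoMatrix_eq_zero_eq` (`K_ℓ` literally = the order-condition set) and the tree's counting
  theorems transported to the printed `K_ℓ`: **`fiteShparlinski_thm_1_det`** ([FS] Theorem 1),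
  **`fiteShparlinski_cor_2_det`** ([FS] Corollary 2).

NOT here: Kubota's Lemma 1 for a general (non-Galois, `F ≠` reflex) CM type (`C` rectangular `m × m*`, `H ≠ 1`)
— the tree's abstract `typeRank_eq_finrank_antiSpan_add_one` covers the rank side, but the matrix `C` indexed by
representatives `φᵢ`, `ψⱼ` is not set up; FGL Prop. 4.7 (`rk(D_k) = #{χ ∈ X_k^− : Σ_{M_k} χ ≠ 0}`) is in the tree in
character form (`CyclotomicFermatCMTypesPrimeLevelDegenerate.cmTypeRank_fermat_eq_sub`), not restated for `D`.

## References

* [FiteGonzalezLario2016] F. Fité, J. González, J.-C. Lario, Canad. J. Math. 68 (2016) 361–394, Def. 3.1,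
  Lemma 3.3, Thm. 1.2 = Thm. 4.10.
* [FiteShparlinski2016] F. Fité, I. E. Shparlinski, Proc. AMS 144 (2016) 55–63, §1, Lemma 6, Thm. 1, Cor. 2.
* [Kubota1965] T. Kubota, Trans. AMS 118 (1965) 113–122, §2 (the matrix `C`, the rank) and Lemma 1.
* [KoblitzRohrlich1978] N. Koblitz, D. Rohrlich, Canad. J. Math. 30 (1978), Theorem 2 (`W_{r,s,t}`).
* [Shimura1998] G. Shimura, *Abelian varieties with complex multiplication and modular functions*, §32.10.

## Provenance

Cell `pub-hodgecm2` (COR-CM), literature seat `lit-deligne-3` gen 17 (claim DEMJANENKO-RANK; count-neutral).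
-/

noncomputable section

namespace Literature.AlgebraicGeometry.ComplexMultiplication

open Literature.NumberTheory.ComplexMultiplication

section General

variable {G : Type*} [Group G]

/-! ## §0 Two generalities on CM types `M ⊆ G` (`G` acting on itself by left multiplication) -/

/-- Every vector of `U = span{u_g}` is `ρ`-odd: `u(ρx) = −u(x)` (each `u_g` is, `translateInd_rho_smul`). [folklore] -/
private theorem apply_rho_mul_of_mem_antiSpan {ρ : G} {M : Finset G} (h : IsCMTypeWith ρ (↑M : Set G))
    {u : G → ℚ} (hu : u ∈ antiSpan G (↑M : Set G)) (x : G) : u (ρ * x) = -u x := by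
  induction hu using Submodule.span_induction generalizing x with
  | mem v hv =>
    obtain ⟨g, rfl⟩ := hv
    have h1 := h.translateInd_rho_smul g x
    simp only [smul_eq_mul] at h1
    simp only [antiVec, h1]
    ring
  | zero => simp
  | add v w _ _ hv hw => simp only [Pi.add_apply, hv x, hw x, neg_add]
  | smul t v _ hv => simp only [Pi.smul_apply, smul_eq_mul, hv x, mul_neg]

/-- `ρ² = 1` in `G` (the conjugation is an involution). [folklore] -/
private theorem rho_mul_rho {ρ : G} {M : Finset G} (h : IsCMTypeWith ρ (↑M : Set G)) : ρ * ρ = 1 := by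
  have h1 := h.invol (1 : G)
  simp only [smul_eq_mul, mul_one] at h1
  exact h1

/-! ## §1 The (generalized) Demjanenko matrix of a half-system `M ⊆ G` -/

variable [DecidableEq G]

/-- **The (generalized) Demjanenko matrix** of a subset `M` of a group `G` with respect to an element `ρ`
(the complex conjugation): `D = (E(ρ c⁻¹ a) − 1/2)_{c, a ∈ M}` where `E(x) = 0` if `x ∈ M` and `E(x) = 1` if
`x ∉ M` — Fité–González–Lario: "For `a ∈ G` define `E_k(a) := 0` if `a ∈ M_k`, `1` if `a ∉ M_k`.  The generalized
`k`-Demjanenko matrix is defined as `D_k := (E_k(−c⁻¹a) − 1/2)_{c,a ∈ M_k/W_k}`" (there `G = (ℤ/ℓ)^* / W_k`,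
`ρ = −1`); Fité–Shparlinski §1: "`D_{k,ℓ} := (E_{k,ℓ}(−c⁻¹a) − 1/2)_{c,a ∈ M_{k,ℓ}/W_{k,ℓ}}`".  Rows and columns are
indexed by the subtype of `M`; for a CM type its entries are `±1/2` (`demjanenkoMatrix_apply_eq`: one half of
Shimura's `(φ − φρ)`-vector of the translate by `c⁻¹`, i.e. `D = ½ Cᵀ` for Kubota's `±1`-matrix `C`).
[cite: FiteGonzalezLario2016, Definition 3.1] [cite: FiteShparlinski2016, §1] -/
def demjanenkoMatrix (ρ : G) (M : Finset G) : Matrix M M ℚ :=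
  Matrix.of fun c a => (if ρ * ((c : G)⁻¹ * a) ∈ M then (0 : ℚ) else 1) - 1 / 2

/-- The entries of the Demjanenko matrix, as printed: `D_{c,a} = E(ρ c⁻¹ a) − 1/2`.
[cite: FiteGonzalezLario2016, Definition 3.1] -/
theorem demjanenkoMatrix_apply (ρ : G) (M : Finset G) (c a : M) :
    demjanenkoMatrix ρ M c a = (if ρ * ((c : G)⁻¹ * a) ∈ M then (0 : ℚ) else 1) - 1 / 2 := rfl

/-- For a CM type `M` (`x ∈ M ↔ ρx ∉ M`): `D_{c,a} = 1/2` if `c⁻¹a ∈ M` and `−1/2` otherwise, i.e.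
`D_{c,a} = ½ · u_{c⁻¹}(a)` for the `±1`-vector `u_g = 2·𝟙_{g⁻¹M} − 1` of the translate of `M` by `g = c⁻¹`
(Kubota's `γ = 1` if `φψ ∈ S`, `−1` otherwise). [cite: Kubota1965, §2 (p. 115)]
[cite: FiteGonzalezLario2016, Definition 3.1] -/
theorem demjanenkoMatrix_apply_eq {ρ : G} {M : Finset G} (h : IsCMTypeWith ρ (↑M : Set G)) (c a : M) :
    demjanenkoMatrix ρ M c a = antiVec (↑M : Set G) ((c : G)⁻¹) (a : G) / 2 := by
  rw [demjanenkoMatrix_apply, antiVec]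
  by_cases hx : (c : G)⁻¹ * (a : G) ∈ M
  · have h1 : ρ • ((c : G)⁻¹ * (a : G)) ∉ (↑M : Set G) := (h.mem_iff _).1 (Finset.mem_coe.2 hx)
    rw [smul_eq_mul, Finset.mem_coe] at h1
    have h2 : translateInd (↑M : Set G) ((c : G)⁻¹) (a : G) = 1 :=
      translateInd_of_mem (by rw [smul_eq_mul, Finset.mem_coe]; exact hx)
    rw [if_neg h1, h2]
    norm_num
  · have h1 : ρ • ((c : G)⁻¹ * (a : G)) ∈ (↑M : Set G) :=
      (h.rho_smul_mem_iff _).2 (by rw [Finset.mem_coe]; exact hx)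
    rw [smul_eq_mul, Finset.mem_coe] at h1
    have h2 : translateInd (↑M : Set G) ((c : G)⁻¹) (a : G) = 0 :=
      translateInd_of_not_mem (by rw [smul_eq_mul, Finset.mem_coe]; exact hx)
    rw [if_pos h1, h2]
    norm_num

/-- `2 · D_{c,a} ∈ {±1}`: the entries of `2D` are Kubota's `γ = ±1`. [cite: Kubota1965, §2 (p. 115)] -/
theorem two_mul_demjanenkoMatrix_apply_mem {ρ : G} {M : Finset G} (h : IsCMTypeWith ρ (↑M : Set G)) (c a : M) :
    2 * demjanenkoMatrix ρ M c a = 1 ∨ 2 * demjanenkoMatrix ρ M c a = -1 := by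
  rw [demjanenkoMatrix_apply_eq h, antiVec]
  by_cases hx : (c : G)⁻¹ • (a : G) ∈ (↑M : Set G)
  · rw [translateInd_of_mem hx]; norm_num
  · rw [translateInd_of_not_mem hx]; norm_num

/-! ## §2 Kubota's Lemma 1 / Fité–González–Lario Lemma 3.3: `rank(M) = rk(D) + 1` -/

/-- The rows `{u_{c⁻¹} : c ∈ M}` already span `U = span{u_g : g ∈ G}`: every `g` is `c⁻¹` or `c⁻¹ρ` with
`c ∈ M`, and `u_{gρ} = −u_g` (Kubota: `C` is indexed by representatives `φᵢ`, `ψⱼ`; FGL: "the matrix of `Φ*_k`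
in the basis `M_k/W_k ∪ M_{−k}/W_k`"). [cite: FiteGonzalezLario2016, Lemma 3.3 (proof)] -/
private theorem span_range_antiVec_inv_eq {ρ : G} {M : Finset G} (h : IsCMTypeWith ρ (↑M : Set G)) :
    Submodule.span ℚ (Set.range fun c : M => antiVec (↑M : Set G) ((c : G)⁻¹)) = antiSpan G (↑M : Set G) := by
  apply le_antisymm
  · apply Submodule.span_mono
    rintro _ ⟨c, rfl⟩
    exact ⟨(c : G)⁻¹, rfl⟩
  · apply Submodule.span_le.2
    rintro _ ⟨g, rfl⟩
    by_cases hg : g⁻¹ ∈ M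
    · refine Submodule.subset_span ⟨⟨g⁻¹, hg⟩, ?_⟩
      simp only [inv_inv]
    · have hρg : ρ * g⁻¹ ∈ M := by
        have h1 : ρ • g⁻¹ ∈ (↑M : Set G) := (h.rho_smul_mem_iff _).2 (by rw [Finset.mem_coe]; exact hg)
        rw [smul_eq_mul, Finset.mem_coe] at h1
        exact h1
      have hρinv : ρ⁻¹ = ρ := inv_eq_of_mul_eq_one_right (rho_mul_rho h)
      have hinv : (ρ * g⁻¹)⁻¹ = g * ρ := by rw [mul_inv_rev, inv_inv, hρinv]
      have hneg : antiVec (↑M : Set G) g = -antiVec (↑M : Set G) ((ρ * g⁻¹)⁻¹) := by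
        funext x
        rw [hinv, Pi.neg_apply]
        simp only [antiVec, h.translateInd_mul_rho]
        ring
      show antiVec (↑M : Set G) g ∈ _
      rw [hneg]
      exact Submodule.neg_mem _ (Submodule.subset_span ⟨⟨ρ * g⁻¹, hρg⟩, rfl⟩)

/-- `rk(D) ≤ |M| = n` ("`rank(F; {φᵢ}) ≤ m + 1` obviously"). [cite: Kubota1965, §2 (p. 115)] -/
theorem rank_demjanenkoMatrix_le (ρ : G) (M : Finset G) : (demjanenkoMatrix ρ M).rank ≤ M.card := by
  have h1 := Matrix.rank_le_card_width (demjanenkoMatrix ρ M)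
  rwa [Fintype.card_coe] at h1

/-- A square matrix over `ℚ` has full rank iff its determinant is non-zero. [folklore] -/
private theorem rank_eq_card_iff_det_ne_zero {m : Type*} [Fintype m] [DecidableEq m] (A : Matrix m m ℚ) :
    A.rank = Fintype.card m ↔ A.det ≠ 0 := by
  constructor
  · intro hr
    have hli : LinearIndependent ℚ A.row := by
      rw [linearIndependent_iff_card_eq_finrank_span, Set.finrank, ← Matrix.rank_eq_finrank_span_row, hr]
    have hU : IsUnit A := Matrix.linearIndependent_rows_iff_isUnit.1 hli
    exact ((Matrix.isUnit_iff_isUnit_det A).1 hU).ne_zero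
  · intro hd
    exact Matrix.rank_of_isUnit A ((Matrix.isUnit_iff_isUnit_det A).2 (isUnit_iff_ne_zero.2 hd))

variable [Fintype G]

/-- **Kubota 1965, Lemma 1 / Fité–González–Lario 2016, Lemma 3.3: `rank(M) = rk(D) + 1`.**  For a CM type `M`
of a finite group `G` (for the central involution `ρ`: `x ∈ M ↔ ρx ∉ M`), the Kubota–Dodson rank of `M` — the
dimension of the span of the indicator vectors of all translates `g⁻¹M` (the tree's `typeRank`; Kubota:
"the dimension of `P(G)^Φ`"; FGL: "the rank of `Φ*_k(ℤ[G/W_k])`") — equals `rk(D) + 1` for the Demjanenko matrix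
`D = (E(ρc⁻¹a) − 1/2)_{c,a ∈ M}` (Kubota §2: "`rank(F; {φᵢ}) = rank C + 1`" as the DEFINITION and Lemma 1 "the
dimension of `P(G)^Φ` over `R` is equal to the rank" as the theorem; FGL Lemma 3.3 "(see Lemma 1 of [Kub65])
The rank of `M_k/W_k` is equal to `rk(D_k) + 1`").  Proof (Shimura §32.10, as in the tree's
`typeRank_eq_finrank_antiSpan_add_one`: `rank = dim U + 1`, `U = span{u_g}`): the rows of `D` are the halves of
the `u_{c⁻¹}`, `c ∈ M`, restricted to `M`; these `u_{c⁻¹}` span `U` (`u_{gρ} = −u_g`), and restriction to `M` is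
injective on `U` because its elements are `ρ`-odd and `M ∪ ρM = G`.
[cite: Kubota1965, §2 Lemma 1 (pp. 115–117)] [cite: FiteGonzalezLario2016, Lemma 3.3] -/
theorem rank_demjanenkoMatrix_add_one {ρ : G} {M : Finset G} (h : IsCMTypeWith ρ (↑M : Set G)) :
    (demjanenkoMatrix ρ M).rank + 1 = typeRank G (↑M : Set G) := by
  classical
  haveI : Nonempty G := ⟨1⟩
  rw [h.typeRank_eq_finrank_antiSpan_add_one, Matrix.rank_eq_finrank_span_row]
  congr 1
  -- restriction to `M` and halving
  set R : (G → ℚ) →ₗ[ℚ] (M → ℚ) := (1 / 2 : ℚ) • LinearMap.funLeft ℚ ℚ (Subtype.val : M → G) with hR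
  have hRapply : ∀ (u : G → ℚ) (a : M), R u a = u a / 2 := fun u a => by
    simp only [hR, LinearMap.smul_apply, Pi.smul_apply, LinearMap.funLeft_apply, smul_eq_mul]
    ring
  have hrow : Set.range (demjanenkoMatrix ρ M).row =
      R '' Set.range (fun c : M => antiVec (↑M : Set G) ((c : G)⁻¹)) := by
    rw [← Set.range_comp]
    congr 1
    funext c
    funext a
    rw [Matrix.row_apply, Function.comp_apply, hRapply, demjanenkoMatrix_apply_eq h]
  rw [hrow, Submodule.span_image, span_range_antiVec_inv_eq h, ← LinearMap.range_domRestrict]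
  -- `R` is injective on `U`
  refine LinearMap.finrank_range_of_inj ?_
  intro u v huv
  apply Subtype.ext
  funext x
  have hzero : ∀ a ∈ M, (u : G → ℚ) a = (v : G → ℚ) a := fun a ha => by
    have h1 := congrFun huv ⟨a, ha⟩
    rw [LinearMap.domRestrict_apply, LinearMap.domRestrict_apply, hRapply, hRapply] at h1
    linarith
  by_cases hx : x ∈ M
  · exact hzero x hx
  · have hρx : ρ * x ∈ M := by
      have h1 : ρ • x ∈ (↑M : Set G) := (h.rho_smul_mem_iff _).2 (by rw [Finset.mem_coe]; exact hx)
      rw [smul_eq_mul, Finset.mem_coe] at h1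
      exact h1
    have hu := apply_rho_mul_of_mem_antiSpan h u.2 x
    have hv := apply_rho_mul_of_mem_antiSpan h v.2 x
    have h1 := hzero _ hρx
    rw [hu, hv] at h1
    linarith

/-- `|M| = |G|/2`: a CM type is half of `G` (`G = M ⊔ ρM`; FS: "This is a set of cardinality `(ℓ−1)/2`").
[cite: FiteShparlinski2016, §1] -/
theorem two_mul_card_eq_card {ρ : G} {M : Finset G} (h : IsCMTypeWith ρ (↑M : Set G)) :
    2 * M.card = Fintype.card G := by
  have hdisj : Disjoint M (M.image (ρ * ·)) := by
    rw [Finset.disjoint_left]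
    intro x hx hx'
    obtain ⟨y, hy, rfl⟩ := Finset.mem_image.1 hx'
    have h1 : ρ • y ∉ (↑M : Set G) := (h.mem_iff y).1 (Finset.mem_coe.2 hy)
    rw [smul_eq_mul, Finset.mem_coe] at h1
    exact h1 hx
  have hunion : M ∪ M.image (ρ * ·) = Finset.univ := by
    ext x
    simp only [Finset.mem_union, Finset.mem_univ, iff_true]
    by_cases hx : x ∈ M
    · exact Or.inl hx
    · refine Or.inr (Finset.mem_image.2 ⟨ρ * x, ?_, ?_⟩)
      · have h1 : ρ • x ∈ (↑M : Set G) := (h.rho_smul_mem_iff _).2 (by rw [Finset.mem_coe]; exact hx)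
        rw [smul_eq_mul, Finset.mem_coe] at h1
        exact h1
      · have h1 := h.invol x
        simp only [smul_eq_mul] at h1
        exact h1
  have hcard : (M.image (ρ * ·)).card = M.card :=
    Finset.card_image_of_injective _ (mul_right_injective ρ)
  rw [← Finset.card_univ, ← hunion, Finset.card_union_of_disjoint hdisj, hcard]
  ring

/-- **Nondegenerate iff `D` has full rank**: `rank(M) = n + 1` (`|G| = 2n`) iff `rk(D) = n = |M|` — Kubota:
"We say that `(F; {φᵢ})` … is nondegenerate if `rank(F; {φᵢ}) = m + 1`"; FGL: "`M_k/W_k` is non-degenerate if its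
rank is `r_k + 1`, equivalently, if `rk(D_k)` is maximal". [cite: Kubota1965, §2 (p. 115)]
[cite: FiteGonzalezLario2016, §3 (after Lemma 3.3)] -/
theorem rank_demjanenkoMatrix_eq_card_iff {ρ : G} {M : Finset G} (h : IsCMTypeWith ρ (↑M : Set G)) :
    (demjanenkoMatrix ρ M).rank = M.card ↔ typeRank G (↑M : Set G) = Fintype.card G / 2 + 1 := by
  have h1 := rank_demjanenkoMatrix_add_one h
  have h2 := two_mul_card_eq_card h
  omega

/-- **Nondegenerate iff `det D ≠ 0`** — FGL: "equivalently, if `rk(D_k)` is maximal, that is, if `D_k` has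
determinant distinct from zero"; FS: "`K_ℓ` … the set of `k` for which `D_{k,ℓ}` is singular (equivalently, for
which the rank of the Hodge group of `Jac(C_{k,ℓ})` is not maximal)". [cite: FiteGonzalezLario2016, §3 (after Lemma 3.3)]
[cite: FiteShparlinski2016, §1] -/
theorem det_demjanenkoMatrix_ne_zero_iff {ρ : G} {M : Finset G} (h : IsCMTypeWith ρ (↑M : Set G)) :
    (demjanenkoMatrix ρ M).det ≠ 0 ↔ typeRank G (↑M : Set G) = Fintype.card G / 2 + 1 := by
  rw [← rank_demjanenkoMatrix_eq_card_iff h, ← rank_eq_card_iff_det_ne_zero, Fintype.card_coe]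

/-- The degenerate case: `det D = 0 ↔ rank(M) < n + 1` (the rank never exceeds `n + 1`, tree `typeRank_le`).
[cite: FiteGonzalezLario2016, §3 (after Lemma 3.3)] -/
theorem det_demjanenkoMatrix_eq_zero_iff {ρ : G} {M : Finset G} (h : IsCMTypeWith ρ (↑M : Set G)) :
    (demjanenkoMatrix ρ M).det = 0 ↔ typeRank G (↑M : Set G) < Fintype.card G / 2 + 1 := by
  haveI : Nonempty G := ⟨1⟩
  have h1 := det_demjanenkoMatrix_ne_zero_iff h
  have h2 := h.typeRank_le
  constructor
  · intro hd
    exact lt_of_le_of_ne h2 fun heq => (h1.2 heq) hd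
  · intro hlt
    by_contra hd
    exact absurd (h1.1 hd) (ne_of_lt hlt)

end General

/-! ## §3 The quotient form: `D` on `M/W` for a subgroup `W` stabilising `M` (FGL's `M_k/W_k ⊂ G/W_k`) -/

section Quotient

variable {G : Type*} [Group G] (W : Subgroup G) [W.Normal]

/-- For a subgroup `W` with `WM = M` (FS: "`W_{k,ℓ} := {w ∈ (ℤ/ℓ)^* | wM_{k,ℓ} = M_{k,ℓ}}`"), membership in the
image `M/W ⊆ G/W` is read on representatives: `[x] ∈ M/W ↔ x ∈ M`. [cite: FiteShparlinski2016, §1] -/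
theorem mem_image_mk_iff [DecidableEq (G ⧸ W)] {M : Finset G} (hW : ∀ w ∈ W, ∀ x, w * x ∈ M ↔ x ∈ M) (x : G) :
    (x : G ⧸ W) ∈ M.image (QuotientGroup.mk : G → G ⧸ W) ↔ x ∈ M := by
  constructor
  · intro hx
    obtain ⟨y, hy, hyx⟩ := Finset.mem_image.1 hx
    -- `y⁻¹x ∈ W`, hence `xy⁻¹ ∈ W` (normality) and `x = (xy⁻¹)·y ∈ M`
    have h1 : y⁻¹ * x ∈ W := QuotientGroup.eq.1 hyx
    have h2 : x * y⁻¹ ∈ W := by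
      have := Subgroup.Normal.conj_mem inferInstance _ h1 y
      simpa [mul_assoc] using this
    have h3 := (hW _ h2 y).2 hy
    simpa using h3
  · intro hx
    exact Finset.mem_image.2 ⟨x, hx, rfl⟩

/-- The image `M/W` of a CM type `M` (for `ρ`) stable under `W` is a CM type of `G/W` for the image of `ρ` — FGL:
"`B_k` is an abelian variety with complex multiplication by `F_k := F^{W_k}` and primitive CM type equal to
`M_k/W_k`". [cite: FiteGonzalezLario2016, §3 (before Definition 3.1)] -/
theorem isCMTypeWith_image_mk [DecidableEq (G ⧸ W)] {ρ : G} {M : Finset G} (h : IsCMTypeWith ρ (↑M : Set G))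
    (hW : ∀ w ∈ W, ∀ x, w * x ∈ M ↔ x ∈ M) :
    IsCMTypeWith (ρ : G ⧸ W) (↑(M.image (QuotientGroup.mk : G → G ⧸ W)) : Set (G ⧸ W)) where
  mem_iff q := by
    induction q using QuotientGroup.induction_on with
    | H x =>
      rw [Finset.mem_coe, smul_eq_mul, Finset.mem_coe, ← QuotientGroup.mk_mul, mem_image_mk_iff W hW,
        mem_image_mk_iff W hW]
      have h1 := h.mem_iff x
      rwa [Finset.mem_coe, smul_eq_mul, Finset.mem_coe] at h1
  comm g q := by
    induction g using QuotientGroup.induction_on with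
    | H g =>
      induction q using QuotientGroup.induction_on with
      | H x =>
        have h1 := h.comm g x
        simp only [smul_eq_mul] at h1 ⊢
        rw [← QuotientGroup.mk_mul, ← QuotientGroup.mk_mul, ← QuotientGroup.mk_mul, ← QuotientGroup.mk_mul, h1]
  invol q := by
    induction q using QuotientGroup.induction_on with
    | H x =>
      have h1 := h.invol x
      simp only [smul_eq_mul] at h1 ⊢
      rw [← QuotientGroup.mk_mul, ← QuotientGroup.mk_mul, h1]

/-- **The rank of `M/W` on `G/W` is the rank of `M` on `G`**: pulling functions on `G/W` back to `G` is an
injective linear map carrying the indicator of the translate `[g]⁻¹(M/W)` to the indicator of `g⁻¹M`, so the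
two spans of translates are isomorphic (FGL: "`Φ*_k` is well defined precisely because `W_k` is the subgroup of
`G` fixing `M_k`"; the rank of the induced type equals the rank of the type it is induced from).
[cite: FiteGonzalezLario2016, Definition 3.1 and Remark 3.2] -/
theorem typeRank_image_mk_eq [DecidableEq (G ⧸ W)] {M : Finset G} (hW : ∀ w ∈ W, ∀ x, w * x ∈ M ↔ x ∈ M) :
    typeRank (G ⧸ W) (↑(M.image (QuotientGroup.mk : G → G ⧸ W)) : Set (G ⧸ W)) = typeRank G (↑M : Set G) := by
  set π : ((G ⧸ W) → ℚ) →ₗ[ℚ] (G → ℚ) := LinearMap.funLeft ℚ ℚ (QuotientGroup.mk : G → G ⧸ W) with hπ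
  have hπinj : Function.Injective π :=
    LinearMap.funLeft_injective_of_surjective ℚ ℚ _ (QuotientGroup.mk_surjective (s := W))
  have hpull : ∀ g : G,
      π (translateInd (↑(M.image (QuotientGroup.mk : G → G ⧸ W)) : Set (G ⧸ W)) (g : G ⧸ W)) =
        translateInd (↑M : Set G) g := by
    intro g
    funext x
    rw [hπ, LinearMap.funLeft_apply]
    by_cases hx : g * x ∈ M
    · rw [translateInd_of_mem (Φ := (↑M : Set G)) (by rw [smul_eq_mul, Finset.mem_coe]; exact hx),
        translateInd_of_mem]
      rw [smul_eq_mul, ← QuotientGroup.mk_mul, Finset.mem_coe, mem_image_mk_iff W hW]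
      exact hx
    · rw [translateInd_of_not_mem (Φ := (↑M : Set G)) (by rw [smul_eq_mul, Finset.mem_coe]; exact hx),
        translateInd_of_not_mem]
      rw [smul_eq_mul, ← QuotientGroup.mk_mul, Finset.mem_coe, mem_image_mk_iff W hW]
      exact hx
  have hrange : Set.range (fun g : G => translateInd (↑M : Set G) g) =
      π '' Set.range (fun q : G ⧸ W =>
        translateInd (↑(M.image (QuotientGroup.mk : G → G ⧸ W)) : Set (G ⧸ W)) q) := by
    ext f
    constructor
    · rintro ⟨g, rfl⟩
      exact ⟨_, ⟨(g : G ⧸ W), rfl⟩, hpull g⟩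
    · rintro ⟨_, ⟨q, rfl⟩, rfl⟩
      induction q using QuotientGroup.induction_on with
      | H g => exact ⟨g, (hpull g).symm⟩
  rw [typeRank, typeRank, hrange, Submodule.span_image]
  exact LinearEquiv.finrank_eq (Submodule.equivMapOfInjective π hπinj
    (Submodule.span ℚ (Set.range fun q : G ⧸ W =>
      translateInd (↑(M.image (QuotientGroup.mk : G → G ⧸ W)) : Set (G ⧸ W)) q)))

variable [Fintype (G ⧸ W)] [DecidableEq (G ⧸ W)]

/-- **Fité–González–Lario Lemma 3.3 verbatim, on `M/W`**: "The rank of `M_k/W_k` is equal to `rk(D_k) + 1`" for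
the Demjanenko matrix `D = (E(ρc⁻¹a) − 1/2)_{c,a ∈ M/W}` of the quotient type — and that rank is the rank of `M`
itself. [cite: FiteGonzalezLario2016, Lemma 3.3] [cite: Kubota1965, §2 Lemma 1] -/
theorem rank_demjanenkoMatrix_image_mk_add_one {ρ : G} {M : Finset G} (h : IsCMTypeWith ρ (↑M : Set G))
    (hW : ∀ w ∈ W, ∀ x, w * x ∈ M ↔ x ∈ M) :
    (demjanenkoMatrix (ρ : G ⧸ W) (M.image (QuotientGroup.mk : G → G ⧸ W))).rank + 1 =
      typeRank G (↑M : Set G) := by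
  rw [rank_demjanenkoMatrix_add_one (isCMTypeWith_image_mk W h hW), typeRank_image_mk_eq W hW]

/-- On `M/W`: `det D ≠ 0 ↔ rank(M) = |G/W|/2 + 1` ("`M_k/W_k` is non-degenerate if its rank is `r_k + 1`,
equivalently … if `D_k` has determinant distinct from zero", `r_k = |G/W_k|/2`).
[cite: FiteGonzalezLario2016, §3 (after Lemma 3.3)] -/
theorem det_demjanenkoMatrix_image_mk_ne_zero_iff {ρ : G} {M : Finset G} (h : IsCMTypeWith ρ (↑M : Set G))
    (hW : ∀ w ∈ W, ∀ x, w * x ∈ M ↔ x ∈ M) :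
    (demjanenkoMatrix (ρ : G ⧸ W) (M.image (QuotientGroup.mk : G → G ⧸ W))).det ≠ 0 ↔
      typeRank G (↑M : Set G) = Fintype.card (G ⧸ W) / 2 + 1 := by
  rw [det_demjanenkoMatrix_ne_zero_iff (isCMTypeWith_image_mk W h hW), typeRank_image_mk_eq W hW]

/-- The size of the quotient Demjanenko matrix: `2 · |M/W| = |G/W|` (`r_k = (ℓ−1)/(2n_k)`).
[cite: FiteGonzalezLario2016, Definition 3.1] -/
theorem two_mul_card_image_mk_eq {ρ : G} {M : Finset G} (h : IsCMTypeWith ρ (↑M : Set G))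
    (hW : ∀ w ∈ W, ∀ x, w * x ∈ M ↔ x ∈ M) :
    2 * (M.image (QuotientGroup.mk : G → G ⧸ W)).card = Fintype.card (G ⧸ W) :=
  two_mul_card_eq_card (isCMTypeWith_image_mk W h hW)

end Quotient

/-! ## §4 The CM types `Φ_S` of `ℚ(ζ_N)` read on residues: `rank(Φ_S) = rk(D_S) + 1` -/

namespace CyclotomicFermatCMType

open Literature.AlgebraicGeometry.Pohlmann1968 Literature.AlgebraicGeometry.Pohlmann1968.Cyclotomic
open Literature.AlgebraicGeometry.HodgeTheory (fermatCMType)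

section Level

variable (N : ℕ) [NeZero N] (L : Type) [Field L] [NumberField L] [IsCyclotomicExtension {N} ℚ L]

/-- **`rank(Φ_S) = rk(D_S) + 1` for the CM types of `ℚ(ζ_N)`.**  For a CM residue set `S` (`c ∈ S ↔ −c ∉ S` on
units) the Kubota–Dodson rank of `Φ_S = {σ | e(σ) ∈ S}` (the tree's `cmTypeRank`, = `dim MT`) is `rk(D) + 1` for
the Demjanenko matrix `D = (E(−c⁻¹a) − 1/2)_{c,a ∈ M}` of `M = S ∩ (ℤ/N)ˣ` ("identify `Gal(K/ℚ) ≃ (ℤ/Nℤ)^×`",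
tree `cmTypeRank_cmTypeOfResidues_eq`, then Lemma 3.3). [cite: FiteGonzalezLario2016, Lemma 3.3]
[cite: Kubota1965, §2 Lemma 1] -/
theorem rank_demjanenkoMatrix_unitsFilter_add_one {S : Finset (ZMod N)}
    (hS : ∀ c : ZMod N, c.val.Coprime N → (c ∈ S ↔ -c ∉ S)) :
    (demjanenkoMatrix (-1 : (ZMod N)ˣ) (Finset.univ.filter fun u : (ZMod N)ˣ => (u : ZMod N) ∈ S)).rank + 1 =
      cmTypeRank (cmTypeOfResidues (L := L) S hS) := by
  rw [cmTypeRank_cmTypeOfResidues_eq N L hS, rank_demjanenkoMatrix_add_one (isCMTypeWith_unitsFilter N hS)]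

/-- **`Φ_S` is nondegenerate iff `det D_S ≠ 0`** ("the rank of `D_{k,ℓ}` coincides with the dimension of the Hodge
group"; nondegenerate = rank `φ(N)/2 + 1` = `rk(D) + 1` with `D` of full rank `φ(N)/2 = |M|`).
[cite: FiteShparlinski2016, §1] [cite: FiteGonzalezLario2016, §3 (after Lemma 3.3)] -/
theorem isNondegenerate_cmTypeOfResidues_iff_det_ne_zero {S : Finset (ZMod N)}
    (hS : ∀ c : ZMod N, c.val.Coprime N → (c ∈ S ↔ -c ∉ S)) :
    IsNondegenerate (cmTypeOfResidues (L := L) S hS) ↔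
      (demjanenkoMatrix (-1 : (ZMod N)ˣ) (Finset.univ.filter fun u : (ZMod N)ˣ => (u : ZMod N) ∈ S)).det ≠ 0 := by
  rw [isNondegenerate_iff, cmTypeRank_cmTypeOfResidues_eq N L hS, finrank_eq_totient N L,
    ← ZMod.card_units_eq_totient N, det_demjanenkoMatrix_ne_zero_iff (isCMTypeWith_unitsFilter N hS)]

/-- The degenerate side: `Φ_S` is degenerate iff `D_S` is singular. [cite: FiteShparlinski2016, §1] -/
theorem not_isNondegenerate_cmTypeOfResidues_iff_det_eq_zero {S : Finset (ZMod N)}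
    (hS : ∀ c : ZMod N, c.val.Coprime N → (c ∈ S ↔ -c ∉ S)) :
    ¬ IsNondegenerate (cmTypeOfResidues (L := L) S hS) ↔
      (demjanenkoMatrix (-1 : (ZMod N)ˣ) (Finset.univ.filter fun u : (ZMod N)ˣ => (u : ZMod N) ∈ S)).det = 0 := by
  rw [isNondegenerate_cmTypeOfResidues_iff_det_ne_zero N L hS, not_not]

end Level

/-! ## §5 Prime level: the Demjanenko matrices `D_{k,ℓ}` of the Fermat quotients `C_{k,ℓ}` and [FS] Lemma 6 -/

section Fermat

variable {p : ℕ} [hp : Fact p.Prime]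

/-- **`M_{k,ℓ}` as printed**: for `k ≢ −1`, a unit `j` lies in `M_k = S_k ∩ (ℤ/ℓ)^*` iff `⟨kj⟩ + ⟨j⟩ < ℓ`
("`M_{k,ℓ} := {j ∈ (ℤ/ℓℤ)^* | ⟨kj⟩_ℓ + ⟨j⟩_ℓ < ℓ}`"; tree `mem_fermatCMType_one_iff`).
[cite: FiteShparlinski2016, §1] [cite: FiteGonzalezLario2016, §2] -/
theorem mem_unitsFilter_fermat_iff {k : ZMod p} (hk1 : 1 + k ≠ 0) (j : (ZMod p)ˣ) :
    j ∈ (Finset.univ.filter fun u : (ZMod p)ˣ => (u : ZMod p) ∈ fermatCMType p 1 k (-1 - k)) ↔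
      (k * j).val + (j : ZMod p).val < p := by
  rw [Finset.mem_filter, mem_fermatCMType_one_iff hk1, mul_comm k]
  simp only [Finset.mem_univ, true_and, ne_eq, Units.ne_zero, not_false_eq_true]
  omega

/-- **FGL Theorem 1.2 / Thm. 4.10 for `rk(D_k)`**: for `k ≠ 0, −1` mod `p` the Demjanenko matrix of `M_k ⊂ (ℤ/p)^*`
(`W = 1`) has rank `(p−1)/2 − (p−1)/N_k` ("`rk(D_k) = (ℓ−1)/2 · (1 − 2/N_k)`", `N_k = lcm(ord(−k²−k), ord k)`) when
(b) `ord(−k²−k)`, `ord k` are odd and (c) `v₃(ord k) > v₃(ord(−k²−k))`, and full rank `(p−1)/2` otherwise (tree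
`cmTypeRank_fermat_eq_ite` and Lemma 3.3). [cite: FiteGonzalezLario2016, Thm. 1.2 = Thm. 4.10 and Lemma 3.3] -/
theorem rank_demjanenkoMatrix_fermat_eq_ite {k : ZMod p} (hk : k ≠ 0) (hk1 : 1 + k ≠ 0) :
    (demjanenkoMatrix (-1 : (ZMod p)ˣ)
        (Finset.univ.filter fun u : (ZMod p)ˣ => (u : ZMod p) ∈ fermatCMType p 1 k (-1 - k))).rank =
      (p - 1) / 2 -
        if Odd (orderOf (-k ^ 2 - k)) ∧ Odd (orderOf k) ∧
            padicValNat 3 (orderOf (-k ^ 2 - k)) < padicValNat 3 (orderOf k)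
        then (p - 1) / Nat.lcm (orderOf (-k ^ 2 - k)) (orderOf k) else 0 := by
  haveI : NeZero p := ⟨hp.out.ne_zero⟩
  haveI : NeZero ((p : ℕ) : ℚ) := ⟨Nat.cast_ne_zero.2 hp.out.ne_zero⟩
  haveI : IsCyclotomicExtension {p} ℚ (CyclotomicField p ℚ) := CyclotomicField.isCyclotomicExtension p ℚ
  haveI : NumberField (CyclotomicField p ℚ) := IsCyclotomicExtension.numberField {p} ℚ (CyclotomicField p ℚ)
  have h1 := rank_demjanenkoMatrix_unitsFilter_add_one p (CyclotomicField p ℚ) (fermatCMType_one_cm hk hk1)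
  rw [cmTypeRank_fermat_eq_ite (CyclotomicField p ℚ) hk hk1] at h1
  omega

/-- **`D_k` is singular iff (b) and (c)** ([FS] Lemma 6 (ii)–(iii) for `k` with `W_{k,ℓ} = 1`; FGL Thm. 1.2:
"(ℓ, k) is degenerate if and only if … (b) … (c)"): for `k ≠ 0, −1` mod `p`, `det D_k = 0` iff `ord(−k²−k)` and
`ord k` are odd and `v₃(ord(−k²−k)) < v₃(ord k)` (tree `isNondegenerate_fermat_iff_orderOf`).
[cite: FiteShparlinski2016, Lemma 6] [cite: FiteGonzalezLario2016, Thm. 1.2 = Thm. 4.10] -/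
theorem det_demjanenkoMatrix_fermat_eq_zero_iff {k : ZMod p} (hk : k ≠ 0) (hk1 : 1 + k ≠ 0) :
    (demjanenkoMatrix (-1 : (ZMod p)ˣ)
        (Finset.univ.filter fun u : (ZMod p)ˣ => (u : ZMod p) ∈ fermatCMType p 1 k (-1 - k))).det = 0 ↔
      Odd (orderOf (-k ^ 2 - k)) ∧ Odd (orderOf k) ∧
        padicValNat 3 (orderOf (-k ^ 2 - k)) < padicValNat 3 (orderOf k) := by
  haveI : NeZero p := ⟨hp.out.ne_zero⟩
  haveI : NeZero ((p : ℕ) : ℚ) := ⟨Nat.cast_ne_zero.2 hp.out.ne_zero⟩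
  haveI : IsCyclotomicExtension {p} ℚ (CyclotomicField p ℚ) := CyclotomicField.isCyclotomicExtension p ℚ
  haveI : NumberField (CyclotomicField p ℚ) := IsCyclotomicExtension.numberField {p} ℚ (CyclotomicField p ℚ)
  have h1 := not_isNondegenerate_cmTypeOfResidues_iff_det_eq_zero p (CyclotomicField p ℚ)
    (fermatCMType_one_cm hk hk1)
  rw [isNondegenerate_fermat_iff_orderOf (CyclotomicField p ℚ) hk hk1, not_not] at h1
  exact h1.symm

/-- `rank(Φ_{S_k}) = rk(D_k) + 1` at prime level (any `k ≠ 0, −1`; `D_k` on `M_k` itself).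
[cite: FiteGonzalezLario2016, Lemma 3.3] -/
theorem rank_demjanenkoMatrix_fermat_add_one (L : Type) [Field L] [NumberField L]
    [IsCyclotomicExtension {p} ℚ L] {k : ZMod p}
    {hS : ∀ c : ZMod p, c.val.Coprime p → (c ∈ fermatCMType p 1 k (-1 - k) ↔ -c ∉ fermatCMType p 1 k (-1 - k))} :
    (demjanenkoMatrix (-1 : (ZMod p)ˣ)
        (Finset.univ.filter fun u : (ZMod p)ˣ => (u : ZMod p) ∈ fermatCMType p 1 k (-1 - k))).rank + 1 =
      cmTypeRank (cmTypeOfResidues (L := L) (fermatCMType p 1 k (-1 - k)) hS) := by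
  haveI : NeZero p := ⟨hp.out.ne_zero⟩
  exact rank_demjanenkoMatrix_unitsFilter_add_one p L hS

/-! ### The stabiliser `W_{k,ℓ}` and the quotient matrix `D_{k,ℓ}` on `M_{k,ℓ}/W_{k,ℓ}` -/

open scoped Pointwise

/-- **The stabiliser `W_{k,ℓ} = {w : wM_{k,ℓ} = M_{k,ℓ}}`** (Koblitz–Rohrlich; tree
`forall_mul_mem_fermatCMType_one_iff_iff`): for `k ≠ 0, −1`, a unit `w` stabilises `M_k` iff `w = 1`, or `k` is a
primitive cube root of unity and `w ∈ {k, k²}` ("`W_{k,ℓ}` … has cardinality `3` or `1` depending on whether the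
parameter `k` is a primitive cubic root of unity modulo `ℓ` or not"). [cite: FiteShparlinski2016, §1]
[cite: KoblitzRohrlich1978, Theorem 2] -/
theorem mem_stabilizer_fermat_iff {k : ZMod p} (hk : k ≠ 0) (hk1 : 1 + k ≠ 0) (w : (ZMod p)ˣ) :
    w ∈ MulAction.stabilizer (ZMod p)ˣ
        (Finset.univ.filter fun u : (ZMod p)ˣ => (u : ZMod p) ∈ fermatCMType p 1 k (-1 - k)) ↔
      w = 1 ∨ (k ^ 3 = 1 ∧ k ≠ 1 ∧ ((w : ZMod p) = k ∨ (w : ZMod p) = k ^ 2)) := by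
  rw [MulAction.mem_stabilizer_finset]
  have key : (∀ u : (ZMod p)ˣ,
      w • u ∈ (Finset.univ.filter fun u : (ZMod p)ˣ => (u : ZMod p) ∈ fermatCMType p 1 k (-1 - k)) ↔
        u ∈ (Finset.univ.filter fun u : (ZMod p)ˣ => (u : ZMod p) ∈ fermatCMType p 1 k (-1 - k))) ↔
      ∀ t : ZMod p, (w : ZMod p) * t ∈ fermatCMType p 1 k (-1 - k) ↔ t ∈ fermatCMType p 1 k (-1 - k) := by
    simp only [Finset.mem_filter, Finset.mem_univ, true_and, smul_eq_mul, Units.val_mul]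
    constructor
    · intro H t
      by_cases ht : t = 0
      · rw [ht, mul_zero]
      · exact H (Units.mk0 t ht)
    · intro H u
      exact H u
  rw [key, forall_mul_mem_fermatCMType_one_iff_iff hk hk1 (Units.ne_zero w), Units.val_eq_one]

/-- **`W_{k,ℓ} = 1` unless `ord k = 3`** ("cardinality `3` or `1` depending on whether `k` is a primitive cubic
root of unity modulo `ℓ` or not"). [cite: FiteShparlinski2016, §1] [cite: KoblitzRohrlich1978, Theorem 2] -/
theorem stabilizer_fermat_eq_bot_iff {k : ZMod p} (hk : k ≠ 0) (hk1 : 1 + k ≠ 0) :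
    MulAction.stabilizer (ZMod p)ˣ
        (Finset.univ.filter fun u : (ZMod p)ˣ => (u : ZMod p) ∈ fermatCMType p 1 k (-1 - k)) = ⊥ ↔
      orderOf k ≠ 3 := by
  rw [Ne, orderOf_eq_prime_iff, Subgroup.eq_bot_iff_forall]
  constructor
  · rintro H ⟨hk3, hk1'⟩
    have h1 := H (Units.mk0 k hk) ((mem_stabilizer_fermat_iff hk hk1 _).2 (Or.inr ⟨hk3, hk1', Or.inl rfl⟩))
    exact hk1' (by rw [← Units.val_mk0 hk, h1, Units.val_one])
  · intro H w hw
    rcases (mem_stabilizer_fermat_iff hk hk1 w).1 hw with h | ⟨h3, h1, -⟩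
    · exact h
    · exact absurd ⟨h3, h1⟩ H

/-- `1 + k ≠ 0` and `k ≠ 0` for a primitive cube root of unity `k` (`k² + k + 1 = 0`). [folklore] -/
private theorem ne_zero_and_of_pow_three {k : ZMod p} (hk3 : k ^ 3 = 1) (hk1' : k ≠ 1) : k ≠ 0 ∧ 1 + k ≠ 0 := by
  have hq : k ^ 2 + k + 1 = 0 := by
    have hfac : (k - 1) * (k ^ 2 + k + 1) = 0 := by linear_combination hk3
    exact (mul_eq_zero.1 hfac).resolve_left (sub_ne_zero.2 hk1')
  refine ⟨?_, ?_⟩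
  · rintro rfl
    norm_num at hk3
  · intro h
    have : k = -1 := by linear_combination h
    rw [this] at hq
    norm_num at hq

/-- **For `ord k = 3`: `W_{k,ℓ} = {1, k, k²} = ⟨k⟩`** (Mai's Lemma 1 (v) `kS_k = S_k`; K–R Theorem 2).
[cite: FiteShparlinski2016, §1] [cite: KoblitzRohrlich1978, Theorem 2] -/
theorem stabilizer_fermat_eq_zpowers {k : ZMod p} (hk : k ≠ 0) (hk3 : k ^ 3 = 1) (hk1' : k ≠ 1) :
    MulAction.stabilizer (ZMod p)ˣ
        (Finset.univ.filter fun u : (ZMod p)ˣ => (u : ZMod p) ∈ fermatCMType p 1 k (-1 - k)) =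
      Subgroup.zpowers (Units.mk0 k hk) := by
  have hk1 : 1 + k ≠ 0 := (ne_zero_and_of_pow_three hk3 hk1').2
  have hord : orderOf (Units.mk0 k hk) = 3 := by
    rw [← orderOf_units, Units.val_mk0]
    exact orderOf_eq_prime hk3 hk1'
  ext w
  rw [mem_stabilizer_fermat_iff hk hk1, mem_zpowers_iff_mem_range_orderOf, hord, Finset.mem_image]
  constructor
  · rintro (rfl | ⟨-, -, h | h⟩)
    · exact ⟨0, Finset.mem_range.2 (by norm_num), by rw [pow_zero]⟩
    · exact ⟨1, Finset.mem_range.2 (by norm_num), by rw [pow_one]; exact Units.ext (by rw [Units.val_mk0, h])⟩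
    · exact ⟨2, Finset.mem_range.2 (by norm_num), Units.ext (by rw [Units.val_pow_eq_pow_val, Units.val_mk0, h])⟩
  · rintro ⟨i, hi, rfl⟩
    rw [Finset.mem_range] at hi
    interval_cases i
    · exact Or.inl (pow_zero _)
    · exact Or.inr ⟨hk3, hk1', Or.inl (by rw [pow_one, Units.val_mk0])⟩
    · exact Or.inr ⟨hk3, hk1', Or.inr (by rw [Units.val_pow_eq_pow_val, Units.val_mk0])⟩

/-- `|W_{k,ℓ}| = 3` when `k` is a primitive cube root of unity. [cite: FiteShparlinski2016, §1] -/
theorem card_stabilizer_fermat_of_pow_three {k : ZMod p} (hk3 : k ^ 3 = 1) (hk1' : k ≠ 1) :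
    Nat.card (MulAction.stabilizer (ZMod p)ˣ
        (Finset.univ.filter fun u : (ZMod p)ˣ => (u : ZMod p) ∈ fermatCMType p 1 k (-1 - k))) = 3 := by
  rw [stabilizer_fermat_eq_zpowers (ne_zero_and_of_pow_three hk3 hk1').1 hk3 hk1', Nat.card_zpowers,
    ← orderOf_units, Units.val_mk0]
  exact orderOf_eq_prime hk3 hk1'

/-- The stabiliser acts on `M_k` by left multiplication (`w ∈ W ⟹ (wx ∈ M_k ↔ x ∈ M_k)`). [folklore] -/
private theorem forall_stabilizer_mul_mem_iff (M : Finset (ZMod p)ˣ) :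
    ∀ w ∈ MulAction.stabilizer (ZMod p)ˣ M, ∀ x, w * x ∈ M ↔ x ∈ M := fun w hw x => by
  rw [MulAction.mem_stabilizer_finset] at hw
  exact hw x

/-- **The case `ord k = 3`: `D_{k,ℓ}` (on `M_{k,ℓ}/W_{k,ℓ}`, of size `r_k = (ℓ−1)/6`) is NON-singular** — the
quotient type `M_k/W_k` of `G/W_k` has rank `rk(D_{k,ℓ}) + 1 = rank(Φ_{S_k}) = 1 + (ℓ−1)/6 = r_k + 1`
(tree `cmTypeRank_fermat_of_pow_three_eq_one`; FGL Thm. 1.2 (a) sets these `k` aside, [FS] Lemma 6 (i):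
"`k ∈ K_ℓ` only if `ord k ≠ 3`"). [cite: FiteShparlinski2016, Lemma 6] [cite: FiteGonzalezLario2016, Thm. 1.2 and Lemma 3.3] -/
theorem det_demjanenkoMatrix_quotient_fermat_ne_zero_of_pow_three {k : ZMod p} (hk3 : k ^ 3 = 1) (hk1' : k ≠ 1)
    {W : Subgroup (ZMod p)ˣ} [Fintype ((ZMod p)ˣ ⧸ W)] [DecidableEq ((ZMod p)ˣ ⧸ W)]
    (hW : W = MulAction.stabilizer (ZMod p)ˣ
      (Finset.univ.filter fun u : (ZMod p)ˣ => (u : ZMod p) ∈ fermatCMType p 1 k (-1 - k))) :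
    (demjanenkoMatrix ((-1 : (ZMod p)ˣ) : (ZMod p)ˣ ⧸ W)
        ((Finset.univ.filter fun u : (ZMod p)ˣ => (u : ZMod p) ∈ fermatCMType p 1 k (-1 - k)).image
          (QuotientGroup.mk : (ZMod p)ˣ → (ZMod p)ˣ ⧸ W))).det ≠ 0 := by
  haveI : NeZero p := ⟨hp.out.ne_zero⟩
  haveI : NeZero ((p : ℕ) : ℚ) := ⟨Nat.cast_ne_zero.2 hp.out.ne_zero⟩
  haveI : IsCyclotomicExtension {p} ℚ (CyclotomicField p ℚ) := CyclotomicField.isCyclotomicExtension p ℚ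
  haveI : NumberField (CyclotomicField p ℚ) := IsCyclotomicExtension.numberField {p} ℚ (CyclotomicField p ℚ)
  obtain ⟨hk, hk1⟩ := ne_zero_and_of_pow_three hk3 hk1'
  have hS := fermatCMType_one_cm hk hk1
  have h := isCMTypeWith_unitsFilter p hS
  have hWst : ∀ w ∈ W, ∀ x, w * x ∈ (Finset.univ.filter fun u : (ZMod p)ˣ =>
      (u : ZMod p) ∈ fermatCMType p 1 k (-1 - k)) ↔
        x ∈ (Finset.univ.filter fun u : (ZMod p)ˣ => (u : ZMod p) ∈ fermatCMType p 1 k (-1 - k)) := by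
    rw [hW]
    exact forall_stabilizer_mul_mem_iff _
  rw [det_demjanenkoMatrix_image_mk_ne_zero_iff W h hWst, ← cmTypeRank_cmTypeOfResidues_eq p (CyclotomicField p ℚ) hS,
    cmTypeRank_fermat_of_pow_three_eq_one (CyclotomicField p ℚ) hk3 hk1']
  -- `|G/W| = (p−1)/3`
  have hcardW : Nat.card W = 3 := by rw [hW]; exact card_stabilizer_fermat_of_pow_three hk3 hk1'
  have hlag := Subgroup.card_eq_card_quotient_mul_card_subgroup W
  rw [hcardW, Nat.card_eq_fintype_card, ZMod.card_units p, Nat.card_eq_fintype_card] at hlag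
  omega

/-- **[FS] Lemma 6 verbatim — `K_ℓ` through the Demjanenko matrix `D_{k,ℓ}` on `M_{k,ℓ}/W_{k,ℓ}`.**  For
`k ≠ 0, −1` mod `p` let `W = W_{k,ℓ}` be the stabiliser of `M_{k,ℓ}` and `D_{k,ℓ} = (E(−c⁻¹a) − 1/2)_{c,a ∈ M/W}`.
Then `D_{k,ℓ}` is SINGULAR ("`k ∈ K_ℓ`") iff (i) `ord k ≠ 3`, (ii) `ord k` and `ord(−k²−k)` are odd, and (iii)
`v₃(ord k) > v₃(ord(−k²−k))` ("Lemma 6. For a prime `ℓ ≥ 3` and a positive integer `k ≤ ℓ − 2`, we have `k ∈ K_ℓ`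
if and only if … (i) `ord_ℓ k ≠ 3`; (ii) `ν₂(ord_ℓ k) = ν₂(ord_ℓ(−k²−k)) = 0`; (iii) `ν₃(ord_ℓ k) > ν₃(ord_ℓ(k²+k))`";
`ν₃(ord(k²+k)) = ν₃(ord(−k²−k))`, the two orders differing by a factor `1` or `2`).  For `ord k ≠ 3`, `W = 1` and
`D_{k,ℓ}` is the matrix on `M_{k,ℓ}` of `det_demjanenkoMatrix_fermat_eq_zero_iff`; for `ord k = 3` it is
non-singular (`det_demjanenkoMatrix_quotient_fermat_ne_zero_of_pow_three`).
[cite: FiteShparlinski2016, Lemma 6] [cite: FiteGonzalezLario2016, Thm. 1.2 = Thm. 4.10 and Lemma 3.3] -/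
theorem det_demjanenkoMatrix_quotient_fermat_eq_zero_iff {k : ZMod p} (hk : k ≠ 0) (hk1 : 1 + k ≠ 0)
    {W : Subgroup (ZMod p)ˣ} [Fintype ((ZMod p)ˣ ⧸ W)] [DecidableEq ((ZMod p)ˣ ⧸ W)]
    (hW : W = MulAction.stabilizer (ZMod p)ˣ
      (Finset.univ.filter fun u : (ZMod p)ˣ => (u : ZMod p) ∈ fermatCMType p 1 k (-1 - k))) :
    (demjanenkoMatrix ((-1 : (ZMod p)ˣ) : (ZMod p)ˣ ⧸ W)
        ((Finset.univ.filter fun u : (ZMod p)ˣ => (u : ZMod p) ∈ fermatCMType p 1 k (-1 - k)).image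
          (QuotientGroup.mk : (ZMod p)ˣ → (ZMod p)ˣ ⧸ W))).det = 0 ↔
      orderOf k ≠ 3 ∧ Odd (orderOf (-k ^ 2 - k)) ∧ Odd (orderOf k) ∧
        padicValNat 3 (orderOf (-k ^ 2 - k)) < padicValNat 3 (orderOf k) := by
  haveI : NeZero p := ⟨hp.out.ne_zero⟩
  haveI : NeZero ((p : ℕ) : ℚ) := ⟨Nat.cast_ne_zero.2 hp.out.ne_zero⟩
  haveI : IsCyclotomicExtension {p} ℚ (CyclotomicField p ℚ) := CyclotomicField.isCyclotomicExtension p ℚ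
  haveI : NumberField (CyclotomicField p ℚ) := IsCyclotomicExtension.numberField {p} ℚ (CyclotomicField p ℚ)
  by_cases h3 : orderOf k = 3
  · -- `k` a primitive cube root of unity: `D_{k,ℓ}` is non-singular, (i) fails
    have hk3 : k ^ 3 = 1 ∧ k ≠ 1 := orderOf_eq_prime_iff.1 h3
    have hne := det_demjanenkoMatrix_quotient_fermat_ne_zero_of_pow_three hk3.1 hk3.2 hW
    simp only [hne, h3, ne_eq, not_true_eq_false, false_and]
  · -- `W = 1`: the quotient matrix is the matrix on `M_k`, up to the bijection `G → G/1`
    have hbot : W = ⊥ := by rw [hW]; exact (stabilizer_fermat_eq_bot_iff hk hk1).2 h3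
    have hS := fermatCMType_one_cm hk hk1
    have h := isCMTypeWith_unitsFilter p hS
    have hWst : ∀ w ∈ W, ∀ x, w * x ∈ (Finset.univ.filter fun u : (ZMod p)ˣ =>
        (u : ZMod p) ∈ fermatCMType p 1 k (-1 - k)) ↔
          x ∈ (Finset.univ.filter fun u : (ZMod p)ˣ => (u : ZMod p) ∈ fermatCMType p 1 k (-1 - k)) := by
      rw [hW]
      exact forall_stabilizer_mul_mem_iff _
    have hcard : Fintype.card ((ZMod p)ˣ ⧸ W) = p - 1 := by
      have hlag := Subgroup.card_eq_card_quotient_mul_card_subgroup W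
      rw [hbot, Subgroup.card_bot, Nat.card_eq_fintype_card, ZMod.card_units p, mul_one, ← hbot,
        Nat.card_eq_fintype_card] at hlag
      exact hlag.symm
    have hdet := det_demjanenkoMatrix_image_mk_ne_zero_iff W h hWst
    rw [hcard, ← cmTypeRank_cmTypeOfResidues_eq p (CyclotomicField p ℚ) hS] at hdet
    have hnd : IsNondegenerate (cmTypeOfResidues (L := CyclotomicField p ℚ) (fermatCMType p 1 k (-1 - k)) hS) ↔
        cmTypeRank (cmTypeOfResidues (L := CyclotomicField p ℚ) (fermatCMType p 1 k (-1 - k)) hS) =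
          (p - 1) / 2 + 1 := by
      rw [isNondegenerate_iff, finrank_eq_totient p (CyclotomicField p ℚ), Nat.totient_prime hp.out]
    rw [← hnd, isNondegenerate_fermat_iff_orderOf (CyclotomicField p ℚ) hk hk1] at hdet
    simp only [ne_eq, h3, not_false_eq_true, true_and]
    exact not_iff_not.1 hdet

end Fermat

/-! ## §6 [FS] Theorem 1 and Corollary 2 with `K_ℓ` LITERALLY the set of `k` for which `D_{k,ℓ}` is singular -/

section Verbatim

variable {p : ℕ} [hp : Fact p.Prime]

open scoped Pointwise

open scoped Classical in
/-- **`K_ℓ` as printed = the order conditions.**  Among `1 ≤ k ≤ ℓ − 2` (residues `k ≠ 0, −1`), the set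
`K_ℓ = {k : D_{k,ℓ} singular}` — `D_{k,ℓ}` the Demjanenko matrix on `M_{k,ℓ}/W_{k,ℓ}`, `W_{k,ℓ}` the stabiliser —
is the set cut out by Lemma 6 (i)–(iii) (the form in which the tree's counting theorems
`CyclotomicFermatCMTypesPrimeLevelThreshold.fiteShparlinski_thm_1` / `_cor_2` are stated). [cite: FiteShparlinski2016, Lemma 6] -/
theorem filter_det_demjanenkoMatrix_eq_zero_eq :
    (Finset.univ.filter (fun k : ZMod p => k ≠ 0 ∧ k + 1 ≠ 0)).filter (fun k : ZMod p =>
        (demjanenkoMatrix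
          ((-1 : (ZMod p)ˣ) : (ZMod p)ˣ ⧸ MulAction.stabilizer (ZMod p)ˣ
            (Finset.univ.filter fun u : (ZMod p)ˣ => (u : ZMod p) ∈ fermatCMType p 1 k (-1 - k)))
          ((Finset.univ.filter fun u : (ZMod p)ˣ => (u : ZMod p) ∈ fermatCMType p 1 k (-1 - k)).image
            (QuotientGroup.mk : (ZMod p)ˣ → (ZMod p)ˣ ⧸ MulAction.stabilizer (ZMod p)ˣ
              (Finset.univ.filter fun u : (ZMod p)ˣ => (u : ZMod p) ∈ fermatCMType p 1 k (-1 - k))))).det = 0) =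
      (Finset.univ.filter (fun k : ZMod p => k ≠ 0 ∧ k + 1 ≠ 0)).filter (fun k => orderOf k ≠ 3 ∧
        Odd (orderOf (-k ^ 2 - k)) ∧ Odd (orderOf k) ∧
        padicValNat 3 (orderOf (-k ^ 2 - k)) < padicValNat 3 (orderOf k)) := by
  apply Finset.filter_congr
  intro k hk
  rw [Finset.mem_filter] at hk
  have hk1 : 1 + k ≠ 0 := by rw [add_comm]; exact hk.2.2
  exact det_demjanenkoMatrix_quotient_fermat_eq_zero_iff hk.2.1 hk1 rfl

open scoped Classical in
/-- **Fité–Shparlinski 2016, THEOREM 1, with `K_ℓ` verbatim.**  «Let `ℓ − 1 = 2^α 3^β m` for some integers `α > 0`,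
`β ≥ 0` and `m` with `gcd(m, 6) = 1`.  Then `|#K_ℓ − ℓ(1 − 3^{−2β})/2^{2α+2}| ≤ 4β²√ℓ + 33/16`», where «`K_ℓ`
denote[s] the set of positive integers `k ≤ ℓ − 2` for which `D_{k,ℓ}` is singular» and `D_{k,ℓ}` is the
Demjanenko matrix `(E_{k,ℓ}(−c⁻¹a) − 1/2)_{c,a ∈ M_{k,ℓ}/W_{k,ℓ}}` — the tree's `fiteShparlinski_thm_1` (stated with
Lemma 6's order conditions) transported along `filter_det_demjanenkoMatrix_eq_zero_eq`.
[cite: FiteShparlinski2016, Theorem 1] -/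
theorem fiteShparlinski_thm_1_det {α β m : ℕ} (hℓ : p - 1 = 2 ^ α * 3 ^ β * m) (hα : 0 < α)
    (hm : Nat.Coprime m 6) : |(((Finset.univ.filter (fun k : ZMod p => k ≠ 0 ∧ k + 1 ≠ 0)).filter (fun k : ZMod p =>
        (demjanenkoMatrix
          ((-1 : (ZMod p)ˣ) : (ZMod p)ˣ ⧸ MulAction.stabilizer (ZMod p)ˣ
            (Finset.univ.filter fun u : (ZMod p)ˣ => (u : ZMod p) ∈ fermatCMType p 1 k (-1 - k)))
          ((Finset.univ.filter fun u : (ZMod p)ˣ => (u : ZMod p) ∈ fermatCMType p 1 k (-1 - k)).image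
            (QuotientGroup.mk : (ZMod p)ˣ → (ZMod p)ˣ ⧸ MulAction.stabilizer (ZMod p)ˣ
              (Finset.univ.filter fun u : (ZMod p)ˣ => (u : ZMod p) ∈ fermatCMType p 1 k (-1 - k))))).det = 0)).card : ℝ)
      - (p : ℝ) * (1 - 1 / 3 ^ (2 * β)) / 2 ^ (2 * α + 2)| ≤ 4 * (β : ℝ) ^ 2 * Real.sqrt p + 33 / 16 := by
  rw [filter_det_demjanenkoMatrix_eq_zero_eq]
  exact fiteShparlinski_thm_1 hℓ hα hm

open scoped Classical in
/-- **Fité–Shparlinski 2016, COROLLARY 2, with `K_ℓ` verbatim.**  «Let `ℓ − 1 = 2^α 3^β m` for some integers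
`α, β > 0` and `m` with `gcd(m, 6) = 1`.  If `ℓ > 441 · 2^{4α} β⁴` then `#K_ℓ > 0`»: there is `1 ≤ k ≤ ℓ − 2` whose
Demjanenko matrix `D_{k,ℓ}` (on `M_{k,ℓ}/W_{k,ℓ}`) is singular — the tree's `fiteShparlinski_cor_2` read through
[FS] Lemma 6. [cite: FiteShparlinski2016, Corollary 2] -/
theorem fiteShparlinski_cor_2_det {α β m : ℕ} (hℓ : p - 1 = 2 ^ α * 3 ^ β * m) (hα : 0 < α) (hβ : 0 < β)
    (hm : Nat.Coprime m 6) (hbig : 441 * 2 ^ (4 * α) * β ^ 4 < p) :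
    0 < ((Finset.univ.filter (fun k : ZMod p => k ≠ 0 ∧ k + 1 ≠ 0)).filter (fun k : ZMod p =>
        (demjanenkoMatrix
          ((-1 : (ZMod p)ˣ) : (ZMod p)ˣ ⧸ MulAction.stabilizer (ZMod p)ˣ
            (Finset.univ.filter fun u : (ZMod p)ˣ => (u : ZMod p) ∈ fermatCMType p 1 k (-1 - k)))
          ((Finset.univ.filter fun u : (ZMod p)ˣ => (u : ZMod p) ∈ fermatCMType p 1 k (-1 - k)).image
            (QuotientGroup.mk : (ZMod p)ˣ → (ZMod p)ˣ ⧸ MulAction.stabilizer (ZMod p)ˣ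
              (Finset.univ.filter fun u : (ZMod p)ˣ => (u : ZMod p) ∈ fermatCMType p 1 k (-1 - k))))).det = 0)).card := by
  haveI : NeZero p := ⟨hp.out.ne_zero⟩
  haveI : NeZero ((p : ℕ) : ℚ) := ⟨Nat.cast_ne_zero.2 hp.out.ne_zero⟩
  haveI : IsCyclotomicExtension {p} ℚ (CyclotomicField p ℚ) := CyclotomicField.isCyclotomicExtension p ℚ
  haveI : NumberField (CyclotomicField p ℚ) := IsCyclotomicExtension.numberField {p} ℚ (CyclotomicField p ℚ)
  rw [filter_det_demjanenkoMatrix_eq_zero_eq, Finset.card_pos]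
  obtain ⟨a, ha, ha1, h3, hnd⟩ := fiteShparlinski_cor_2 (CyclotomicField p ℚ) hℓ hα hβ hm hbig
  refine ⟨a, Finset.mem_filter.2 ⟨Finset.mem_filter.2 ⟨Finset.mem_univ _, ha, by rw [add_comm]; exact ha1⟩,
    h3, ?_⟩⟩
  rw [isNondegenerate_fermat_iff_orderOf (CyclotomicField p ℚ) ha ha1, not_not] at hnd
  exact hnd

end Verbatim

end CyclotomicFermatCMType

end Literature.AlgebraicGeometry.ComplexMultiplication
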